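import Summits.AnomalousDissipation.AnomalousDissipation.Theses.CriticalLayer
import Summits.AnomalousDissipation.AnomalousDissipation.Theorems.ImpulseGridBoundedEnergyNoLeakGridOfNoMeanLeakage
import HarnessLib

/-!
# Birth skeleton (BC3) for the piece `CriticalLayer.ShearInjectionSign` (stmt-AnomalousDissipation-1013) of the BC2 redirect
# of `KolmogorovObliqueThesis` (stmt-AnomalousDissipation-1010)

Line `momentum-flux`: transport the sign question from the shear INJECTION `P_s = F∫ sin(2πk x₂) u₁` to the REYNOLDS STRESS of
the forced shear mode `R = ∫ u₁ u₂ cos(2πk x₂)`, through the exact mean momentum balance of that mode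
(`4π²k²ν ⟨P_s⟩ = F²/2 + 2πkF ⟨R⟩`, support item `MeanMomentumBalanceShearMode` stmt-1016, Banach-limit form): with `F > 0`
the affine map is increasing, so `liminf-mean P_s ≥ −δ ⟺ liminf-mean R ≥ −F/(4πk) − (2πkν/F) δ` (stub (i), provable, M: the
identity on `[0, T]` up to `O(1)` boundary terms from the weak formulation tested with the steady shear field, then Cesàro/liminf
algebra).  The crux in the new variable (stub (ii), the bet): the Reynolds stress of a bounded-energy family cannot undershoot
the force's own momentum flux `−F/(4πk)` by more than `O(ν_j)` — no anti-phase locking of the shear mode against its force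
(Frisch 1995 (9.60), Meshalkin–Sinai; DNS friction/stress coefficients: Musacchio–Boffetta 2014 §3.1).  Two stubs; the
composition `shearInjectionSign_of` is proved (forward cap = landed absorbing ball).
-/

set_option linter.dupNamespace false

noncomputable section

open MeasureTheory Filter Set
open scoped InnerProductSpace RealInnerProductSpace ENNReal
open Literature.Analysis.FunctionSpaces Literature.Analysis.FunctionSpaces.Torus
open Literature.Analysis.FluidPDE Literature.Analysis.FluidPDE.Torus
open Summit.AnomalousDissipation.AnomalousDissipation.Theses

namespace Summit.AnomalousDissipation.AnomalousDissipation.Cruxes.KolmogorovObliqueThesis.BirthShearInjectionSign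

local notation "𝕋³" => UnitAddTorus (Fin 3)
local notation "E³" => EuclideanSpace ℝ (Fin 3)

/-- **stub (i) — momentum-flux transport of the liminf (provable, M).** For `F > 0`, `k ≥ 1`, `ν > 0`, one global Leray–Hopf
solution driven by `f_{F,G,k,m}` with a forward kinetic-energy cap, and any `δ`: the liminf-mean shear injection is `≥ −δ` iff
the liminf-mean Reynolds stress `∫ u₁u₂ cos(2πk x₂)` is `≥ −F/(4πk) − (2πkν/F)δ` (exact momentum balance of the forced shear
mode on `[0,T]`, boundary terms `O(1)`, divided by `T`; `liminf` commutes with the increasing affine map). -/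
theorem stub_momentumFluxTransport :
    ∀ (F G : ℝ) (k m : ℕ) (ν : ℝ) (u₀ : 𝕋³ → E³) (u : ℝ → 𝕋³ → E³), 0 < F → 0 < k → 0 < ν →
      IsGlobalLerayHopf ν (fun _ => (fun x : 𝕋³ => (F * (UnitAddTorus.mFourier (Pi.single (1 : Fin 3) (k : ℤ)) x).im) • (EuclideanSpace.single (0 : Fin 3) (1 : ℝ) : E³) + (G * (UnitAddTorus.mFourier (Pi.single (0 : Fin 3) (m : ℤ)) x).im) • (EuclideanSpace.single (1 : Fin 3) (1 : ℝ) : E³))) u₀ u →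
      (∃ C : ℝ, ∀ t : ℝ, 0 ≤ t → kineticEnergy (u t) ≤ C) →
      ∀ δ : ℝ,
        (-δ ≤ longTimeAvgInf (fun t => ∫ x, ⟪(fun x : 𝕋³ => (F * (UnitAddTorus.mFourier (Pi.single (1 : Fin 3) (k : ℤ)) x).im) • (EuclideanSpace.single (0 : Fin 3) (1 : ℝ) : E³)) x, u t x⟫) ↔
          -(F / (4 * Real.pi * k)) - (2 * Real.pi * k * ν / F) * δ ≤
            longTimeAvgInf (fun t => ∫ x, (u t x 0 * u t x 1) * (UnitAddTorus.mFourier (Pi.single (1 : Fin 3) (k : ℤ)) x).re)) := by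
  sorry

/-- **stub (ii) (hardest, the bet) — the Reynolds stress cannot undershoot the forcing momentum flux by more than `O(ν_j)`.**
For `F > 0`, `k, m ≥ 1`, any `G` and every bounded-energy global Leray–Hopf family driven by `f_{F,G,k,m}` at `ν_j → 0`:
`∀ δ > 0`, eventually in `j`, `liminf-mean ∫ u₁u₂cos(2πk x₂) ≥ −F/(4πk) − (2πkν_j/F) δ`.  Why it might fail: an `m > k`
Meshalkin–Sinai negative-eddy-viscosity state pumping the shear channel in anti-phase (Frisch 1995 (9.59)–(9.60)). -/
theorem stub_reynoldsStressFloor :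
    ∀ (F G : ℝ) (k m : ℕ) (ν : ℕ → ℝ) (u₀ : ℕ → 𝕋³ → E³) (u : ℕ → ℝ → 𝕋³ → E³), 0 < F → 0 < k → 0 < m → (∀ j, 0 < ν j) →
      Filter.Tendsto ν Filter.atTop (nhds 0) →
      (∀ j, IsGlobalLerayHopf (ν j) (fun _ => (fun x : 𝕋³ => (F * (UnitAddTorus.mFourier (Pi.single (1 : Fin 3) (k : ℤ)) x).im) • (EuclideanSpace.single (0 : Fin 3) (1 : ℝ) : E³) + (G * (UnitAddTorus.mFourier (Pi.single (0 : Fin 3) (m : ℤ)) x).im) • (EuclideanSpace.single (1 : Fin 3) (1 : ℝ) : E³))) (u₀ j) (u j)) →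
      (∃ E : ℝ, ∀ j, meanEnergy (u j) ≤ E) →
      ∀ δ : ℝ, 0 < δ → ∀ᶠ j in Filter.atTop,
        -(F / (4 * Real.pi * k)) - (2 * Real.pi * k * ν j / F) * δ ≤
          longTimeAvgInf (fun t => ∫ x, (u j t x 0 * u j t x 1) * (UnitAddTorus.mFourier (Pi.single (1 : Fin 3) (k : ℤ)) x).re) := by
  sorry

/-- **Composition (proved, kernel-checked modulo the two stubs): the piece `CriticalLayer.ShearInjectionSign` by name**, with
the forward cap of each `u j` from the landed absorbing ball (`Theorems.absorbingBallLHTorus_of_stub`) and the force regularity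
from the route's support item `CriticalLayer.KolmogorovObliqueForceRegular` (stmt-1015, a registered obligation by name; proved
in `Cruxes/KolmogorovObliqueThesis/BC2Redirect.lean`). -/
theorem ShearInjectionSign_of (hreg : CriticalLayer.KolmogorovObliqueForceRegular) : CriticalLayer.ShearInjectionSign := by
  intro F G k m ν u₀ u hF hk hm hν hν0 hLH hE δ hδ
  obtain ⟨hfs, -, hf0⟩ := hreg F G k m
  filter_upwards [stub_reynoldsStressFloor F G k m ν u₀ u hF hk hm hν hν0 hLH hE δ hδ] with j hj
  have hcap := Theorems.absorbingBallLHTorus_of_stub (ν j) _ (u₀ j) (u j) (hν j) hfs hf0 (hLH j)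
  exact (stub_momentumFluxTransport F G k m (ν j) (u₀ j) (u j) hF hk (hν j) (hLH j) hcap δ).2 hj

end Summit.AnomalousDissipation.AnomalousDissipation.Cruxes.KolmogorovObliqueThesis.BirthShearInjectionSign

end
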